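import Mathlib

/-!
# Cayley transform of a dissipative operator pencil — the operator algebra

Support for `stub_stieltjesOfPencil` (line `cayley-pencil`, crux `StieltjesRepresentation` of route
`ContactStieltjesMeasure`), part 1/5.

For a family `W : ℝ → K →L[ℝ] K` on a real inner-product space with
(R) `W γ f - W γ' f = (γ' - γ) • W γ (W γ' f)` and (E) `⟪f, W γ f⟫ = γ ‖W γ f‖²` (`γ, γ' > 0`):

* `norm_apply_le` — `‖W γ f‖ ≤ ‖f‖ / γ` from (E) alone (no spectral gap needed);
* `norm_cayley` — the Cayley transform `C = 2 W 1 - 1` is an ISOMETRY, `‖C f‖ = ‖f‖` (Lax–Phillips Ch. II §3 (3.1));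
* `inner_cayley_cayley`, `inner_pow_pow` — `⟪C x, C y⟫ = ⟪x, y⟫`, `⟪C^(m+k) g, C^k g⟫ = ⟪C^m g, g⟫`;
* `apply_pencil_eq` — (R) with `γ' = 1` is `W γ ((γ+1) • h + (γ-1) • C h) = h + C h`;
* `telescope`, `resum` — the inverse-free resummation `(γ+1) • W γ (f - (-q)^n • C^n f) = S_n f + C (S_n f)`,
  `S_n = Σ_{k<n} (-q)^k C^k`, `q = (γ-1)/(γ+1)`, and the remainder bound `‖W γ ((-q)^n • C^n f)‖ ≤ |q|^n ‖f‖ / γ`;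
* `toeplitz_nonneg` — positive-definiteness of the real sequence `c_k = ⟪C^k g, g⟫`:
  `Σ_{m,n<M} a_m a_n c_{|m-n|} = ‖Σ_m a_m C^m g‖² ≥ 0` (the input of Herglotz's theorem).
-/

noncomputable section

open scoped RealInnerProductSpace BigOperators
open Finset

namespace Summit.AtomisticToContinuum.FouriersLaw.Theorems.ContactStieltjesMeasure.CayleyPencil.Algebra

variable {K : Type*} [NormedAddCommGroup K] [InnerProductSpace ℝ K]

variable {W : ℝ → K →L[ℝ] K}

/-! Throughout, the two pencil axioms are carried as explicit hypotheses
`hR : ∀ γ γ', 0 < γ → 0 < γ' → ∀ f, W γ f - W γ' f = (γ' - γ) • W γ (W γ' f)` (resolvent identity) and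
`hE : ∀ γ, 0 < γ → ∀ f, ⟪f, W γ f⟫ = γ * ‖W γ f‖ ^ 2` (energy identity). -/

/-- (E) alone bounds the family: `‖W γ f‖ ≤ ‖f‖ / γ` (Cauchy–Schwarz). [folklore] -/
theorem norm_apply_le
    (hE : ∀ γ : ℝ, 0 < γ → ∀ f : K, inner ℝ f (W γ f) = γ * ‖W γ f‖ ^ 2)
    {γ : ℝ} (hγ : 0 < γ) (f : K) : ‖W γ f‖ ≤ ‖f‖ / γ := by
  have h := hE γ hγ f
  have hcs : inner ℝ f (W γ f) ≤ ‖f‖ * ‖W γ f‖ := real_inner_le_norm _ _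
  rw [h] at hcs
  rw [le_div_iff₀ hγ]
  by_cases h0 : ‖W γ f‖ = 0
  · rw [h0, zero_mul]; exact norm_nonneg _
  · have hpos : 0 < ‖W γ f‖ := lt_of_le_of_ne (norm_nonneg _) (Ne.symm h0)
    have h2 : (‖W γ f‖ * γ) * ‖W γ f‖ ≤ ‖f‖ * ‖W γ f‖ := by nlinarith
    exact le_of_mul_le_mul_right h2 hpos

/-- The Cayley transform `C = 2 W 1 - 1` of the pencil. [folklore] -/
def cayley (W : ℝ → K →L[ℝ] K) : K →L[ℝ] K := (2 : ℝ) • W 1 - ContinuousLinearMap.id ℝ K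

/-- Pointwise formula `C f = 2 • W 1 f - f`. [folklore] -/
theorem cayley_apply (f : K) : cayley W f = (2 : ℝ) • W 1 f - f := rfl

/-- (E) at `γ = 1` makes the Cayley transform an ISOMETRY: `‖C f‖² = 4‖W₁f‖² - 4⟪W₁ f, f⟫ + ‖f‖² = ‖f‖²`. [folklore] -/
theorem norm_cayley
    (hE : ∀ γ : ℝ, 0 < γ → ∀ f : K, inner ℝ f (W γ f) = γ * ‖W γ f‖ ^ 2)
    (f : K) : ‖cayley W f‖ = ‖f‖ := by
  have h1 : inner ℝ f (W 1 f) = ‖W 1 f‖ ^ 2 := by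
    have := hE 1 one_pos f; rwa [one_mul] at this
  have hsq : ‖cayley W f‖ ^ 2 = ‖f‖ ^ 2 := by
    have e : ‖cayley W f‖ ^ 2 = ‖(2 : ℝ) • W 1 f‖ ^ 2 - 2 * inner ℝ ((2 : ℝ) • W 1 f) f + ‖f‖ ^ 2 := by
      rw [cayley_apply]; exact norm_sub_sq_real _ _
    rw [e, norm_smul, real_inner_smul_left, real_inner_comm, h1, Real.norm_eq_abs,
      abs_of_pos (by norm_num : (0:ℝ) < 2)]
    ring
  have h0 : 0 ≤ ‖cayley W f‖ := norm_nonneg _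
  have h0' : 0 ≤ ‖f‖ := norm_nonneg _
  nlinarith [hsq, sq_nonneg (‖cayley W f‖ - ‖f‖), sq_nonneg (‖cayley W f‖ + ‖f‖)]

/-- The Cayley transform as a linear isometry. [folklore] -/
def cayleyIso
    (hE : ∀ γ : ℝ, 0 < γ → ∀ f : K, inner ℝ f (W γ f) = γ * ‖W γ f‖ ^ 2) :
    K →ₗᵢ[ℝ] K :=
  { toLinearMap := (cayley W : K →L[ℝ] K)
    norm_map' := norm_cayley hE }

/-- The isometry `cayleyIso` acts as the Cayley transform. [folklore] -/
theorem cayleyIso_apply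
    (hE : ∀ γ : ℝ, 0 < γ → ∀ f : K, inner ℝ f (W γ f) = γ * ‖W γ f‖ ^ 2)
    (f : K) : cayleyIso hE f = cayley W f := rfl

/-- Isometries preserve inner products: `⟪C x, C y⟫ = ⟪x, y⟫`. [folklore] -/
theorem inner_cayley_cayley
    (hE : ∀ γ : ℝ, 0 < γ → ∀ f : K, inner ℝ f (W γ f) = γ * ‖W γ f‖ ^ 2)
    (x y : K) :
    inner ℝ (cayley W x) (cayley W y) = inner ℝ x y := by
  rw [← cayleyIso_apply hE, ← cayleyIso_apply hE]
  exact (cayleyIso hE).inner_map_map x y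

/-- `C^(n+1) f = C (C^n f)`. [folklore] -/
theorem pow_succ_apply (n : ℕ) (f : K) : (cayley W ^ (n + 1)) f = cayley W ((cayley W ^ n) f) := by
  rw [pow_succ']; rfl

/-- Powers of the Cayley transform are isometric. [folklore] -/
theorem norm_pow_apply
    (hE : ∀ γ : ℝ, 0 < γ → ∀ f : K, inner ℝ f (W γ f) = γ * ‖W γ f‖ ^ 2)
    (n : ℕ) (f : K) : ‖(cayley W ^ n) f‖ = ‖f‖ := by
  induction n with
  | zero => simp
  | succ n ih => rw [pow_succ_apply, norm_cayley hE, ih]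

/-- The moment structure of an isometry: `⟪C^(m+k) g, C^k g⟫ = ⟪C^m g, g⟫`. [folklore] -/
theorem inner_pow_pow
    (hE : ∀ γ : ℝ, 0 < γ → ∀ f : K, inner ℝ f (W γ f) = γ * ‖W γ f‖ ^ 2)
    (m k : ℕ) (g : K) :
    inner ℝ ((cayley W ^ (m + k)) g) ((cayley W ^ k) g) = inner ℝ ((cayley W ^ m) g) g := by
  induction k with
  | zero => simp
  | succ k ih =>
    rw [show m + (k + 1) = (m + k) + 1 by ring, pow_succ_apply, pow_succ_apply, inner_cayley_cayley hE, ih]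

/-- (R) with `γ' = 1`, rewritten through `C`: `W γ ((γ+1) • h + (γ-1) • C h) = h + C h`
(i.e. `W γ ∘ ((γ+1) + (γ-1) C) = 1 + C`). [folklore] -/
theorem apply_pencil_eq
    (hR : ∀ γ γ' : ℝ, 0 < γ → 0 < γ' → ∀ f : K, W γ f - W γ' f = (γ' - γ) • W γ (W γ' f))
    {γ : ℝ} (hγ : 0 < γ) (h : K) :
    W γ ((γ + 1) • h + (γ - 1) • cayley W h) = h + cayley W h := by
  have hR1 := hR γ 1 hγ one_pos h
  -- `hR1 : W γ h - W 1 h = (1 - γ) • W γ (W 1 h)`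
  have key : (γ - 1) • W γ (W 1 h) = W 1 h - W γ h := by
    have e : (γ - 1) • W γ (W 1 h) = -((1 - γ) • W γ (W 1 h)) := by rw [← neg_smul, neg_sub]
    rw [e, ← hR1, neg_sub]
  calc W γ ((γ + 1) • h + (γ - 1) • cayley W h)
      = W γ ((2 : ℝ) • h + (2 : ℝ) • ((γ - 1) • W 1 h)) := by
        congr 1; rw [cayley_apply]; module
    _ = (2 : ℝ) • W γ h + (2 : ℝ) • ((γ - 1) • W γ (W 1 h)) := by simp only [map_add, map_smul]
    _ = (2 : ℝ) • W γ h + (2 : ℝ) • (W 1 h - W γ h) := by rw [key]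
    _ = h + cayley W h := by rw [cayley_apply]; module

/-- The Cayley–Neumann ratio `q = (γ-1)/(γ+1)` has `|q| < 1` for `γ > 0`. [folklore] -/
theorem abs_ratio_lt_one {γ : ℝ} (hγ : 0 < γ) : |(γ - 1) / (γ + 1)| < 1 := by
  rw [abs_div, abs_of_pos (by linarith : 0 < γ + 1), div_lt_one (by linarith)]
  exact abs_sub_lt_iff.mpr ⟨by linarith, by linarith⟩

/-- The partial sums `S_n f = Σ_{k<n} (-q)^k C^k f`. [folklore] -/
def partialSum (W : ℝ → K →L[ℝ] K) (q : ℝ) (n : ℕ) (f : K) : K :=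
  ∑ k ∈ range n, (-q) ^ k • (cayley W ^ k) f

/-- Telescoping: `S_n f + q • C (S_n f) = f - (-q)^n • C^n f`. [folklore] -/
theorem telescope (q : ℝ) (n : ℕ) (f : K) :
    partialSum W q n f + q • cayley W (partialSum W q n f) = f - (-q) ^ n • (cayley W ^ n) f := by
  induction n with
  | zero => simp [partialSum]
  | succ n ih =>
    have hS : partialSum W q (n + 1) f = partialSum W q n f + (-q) ^ n • (cayley W ^ n) f := by
      simp [partialSum, sum_range_succ]
    rw [hS, map_add, map_smul, smul_add, pow_succ_apply]
    have e : partialSum W q n f + (-q) ^ n • (cayley W ^ n) f +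
        (q • cayley W (partialSum W q n f) + q • (-q) ^ n • cayley W ((cayley W ^ n) f)) =
        (partialSum W q n f + q • cayley W (partialSum W q n f)) + (-q) ^ n • (cayley W ^ n) f +
          (q * (-q) ^ n) • cayley W ((cayley W ^ n) f) := by
      rw [smul_smul]; abel
    rw [e, ih, show q * (-q) ^ n = -((-q) ^ (n + 1)) by ring]
    module

/-- **Inverse-free resummation** of `W γ` through the Cayley transform:
`(γ+1) • W γ (f - (-q)^n • C^n f) = S_n f + C (S_n f)`, `q = (γ-1)/(γ+1)`. [folklore] -/
theorem resum
    (hR : ∀ γ γ' : ℝ, 0 < γ → 0 < γ' → ∀ f : K, W γ f - W γ' f = (γ' - γ) • W γ (W γ' f))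
    {γ : ℝ} (hγ : 0 < γ) (n : ℕ) (f : K) :
    (γ + 1) • W γ (f - (-((γ - 1) / (γ + 1))) ^ n • (cayley W ^ n) f) =
      partialSum W ((γ - 1) / (γ + 1)) n f + cayley W (partialSum W ((γ - 1) / (γ + 1)) n f) := by
  set q : ℝ := (γ - 1) / (γ + 1) with hq
  have hγ1 : (γ + 1) ≠ 0 := by linarith
  have hp := apply_pencil_eq hR hγ (partialSum W q n f)
  have e : (γ + 1) • partialSum W q n f + (γ - 1) • cayley W (partialSum W q n f) =
      (γ + 1) • (partialSum W q n f + q • cayley W (partialSum W q n f)) := by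
    rw [smul_add, smul_smul, hq, mul_div_cancel₀ _ hγ1]
  rw [e, telescope, map_smul] at hp
  exact hp

/-- The remainder of the resummation is geometrically small: `‖W γ ((-q)^n • C^n f)‖ ≤ |q|^n ‖f‖ / γ`. [folklore] -/
theorem norm_remainder_le
    (hE : ∀ γ : ℝ, 0 < γ → ∀ f : K, inner ℝ f (W γ f) = γ * ‖W γ f‖ ^ 2)
    {γ : ℝ} (hγ : 0 < γ) (q : ℝ) (n : ℕ) (f : K) :
    ‖W γ ((-q) ^ n • (cayley W ^ n) f)‖ ≤ |q| ^ n * ‖f‖ / γ := by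
  have h := norm_apply_le hE hγ ((-q) ^ n • (cayley W ^ n) f)
  rw [norm_smul, norm_pow_apply hE, norm_pow, norm_neg, Real.norm_eq_abs] at h
  exact h

/-- Convergence of the resummation: the remainders tend to `0`, so
`(γ+1) ⟪g, W γ g⟫ = lim_n ⟪g, S_n g + C (S_n g)⟫`. [folklore] -/
theorem tendsto_remainder
    (hE : ∀ γ : ℝ, 0 < γ → ∀ f : K, inner ℝ f (W γ f) = γ * ‖W γ f‖ ^ 2)
    {γ : ℝ} (hγ : 0 < γ) (f : K) :
    Filter.Tendsto (fun n : ℕ => W γ ((-((γ - 1) / (γ + 1))) ^ n • (cayley W ^ n) f))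
      Filter.atTop (nhds 0) := by
  rw [tendsto_zero_iff_norm_tendsto_zero]
  have hq := abs_ratio_lt_one hγ
  have hlim : Filter.Tendsto (fun n : ℕ => |(γ - 1) / (γ + 1)| ^ n * ‖f‖ / γ) Filter.atTop (nhds 0) := by
    have := (tendsto_pow_atTop_nhds_zero_of_lt_one (abs_nonneg _) hq).mul_const (‖f‖ / γ)
    rw [zero_mul] at this
    refine this.congr fun n => ?_
    ring
  refine squeeze_zero (fun n => norm_nonneg _) (fun n => ?_) hlim
  exact norm_remainder_le hE hγ _ n f

/-- **Positive-definiteness of the Cayley moment sequence** `c_k = ⟪C^k g, g⟫` (real, symmetric in `k ↦ -k`):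
for every real `a` and `M`, `Σ_{m,n<M} a_m a_n c_{|m-n|} = ‖Σ_m a_m C^m g‖² ≥ 0`. [folklore] -/
theorem toeplitz_nonneg
    (hE : ∀ γ : ℝ, 0 < γ → ∀ f : K, inner ℝ f (W γ f) = γ * ‖W γ f‖ ^ 2)
    (g : K) (a : ℕ → ℝ) (M : ℕ) :
    0 ≤ ∑ m ∈ range M, ∑ n ∈ range M,
      a m * a n * inner ℝ ((cayley W ^ (max m n - min m n)) g) g := by
  have hterm : ∀ m n : ℕ, inner ℝ ((cayley W ^ (max m n - min m n)) g) g =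
      inner ℝ ((cayley W ^ m) g) ((cayley W ^ n) g) := by
    intro m n
    rcases le_total n m with hnm | hmn
    · rw [max_eq_left hnm, min_eq_right hnm, ← inner_pow_pow hE (m - n) n g, Nat.sub_add_cancel hnm]
    · rw [max_eq_right hmn, min_eq_left hmn, ← inner_pow_pow hE (n - m) m g, Nat.sub_add_cancel hmn,
        real_inner_comm]
  have hsum : ∑ m ∈ range M, ∑ n ∈ range M, a m * a n * inner ℝ ((cayley W ^ (max m n - min m n)) g) g =
      inner ℝ (∑ m ∈ range M, a m • (cayley W ^ m) g) (∑ n ∈ range M, a n • (cayley W ^ n) g) := by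
    rw [sum_inner]
    refine sum_congr rfl fun m _ => ?_
    rw [inner_sum]
    refine sum_congr rfl fun n _ => ?_
    rw [hterm, real_inner_smul_left, real_inner_smul_right]
    ring
  rw [hsum]
  exact real_inner_self_nonneg

/-! ### Registered sub-goal of `stub_stieltjesOfPencil` closed by this file -/

/-- **Sub-goal `stub_stieltjesOfPencil_cayleyToeplitz`** (part 1/5 of `stub_stieltjesOfPencil`, line `cayley-pencil`):
under the energy identity (E), the Cayley moment sequence `k ↦ ⟪C^k g, g⟫`, `C = 2 W 1 - 1`, is Toeplitz-positive
(`toeplitz_nonneg` with the Cayley transform spelled out). [folklore] -/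
theorem stub_stieltjesOfPencil_cayleyToeplitz :
    ∀ (K : Type) [NormedAddCommGroup K] [InnerProductSpace ℝ K] (W : ℝ → K →L[ℝ] K),
      (∀ γ : ℝ, 0 < γ → ∀ f : K, inner ℝ f (W γ f) = γ * ‖W γ f‖ ^ 2) →
      ∀ (g : K) (a : ℕ → ℝ) (M : ℕ), 0 ≤ ∑ m ∈ Finset.range M, ∑ n ∈ Finset.range M,
        a m * a n * inner ℝ ((((2 : ℝ) • W 1 - ContinuousLinearMap.id ℝ K) ^ (max m n - min m n)) g) g := by
  intro K _ _ W hE g a M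
  exact toeplitz_nonneg hE g a M

end Summit.AtomisticToContinuum.FouriersLaw.Theorems.ContactStieltjesMeasure.CayleyPencil.Algebra

end
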